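import Summits.QuantumFields.BalabanUV.Beta.GAN24.DirichletBoxTwoLevel

/-!
# `BalabanUV.Beta.GAN24.DirichletBoxSockets` — binder row G-an2-4 / (CONV-C), road P2 PART III, module M-S: THE TWO SOCKETS OF THE
# DIRICHLET TWO-LEVEL INJECTED LAW FOR GENERAL REGIONS (U = 1 scalar free tower), and the SPELLING-GENERIC BOX END
# (unit b2b-balaban-gan24-p2, gen 23, v1)

HONEST FRAMING (cell contract, verbatim): «discharging `BetaPertH` makes Bałaban's UV stability UNCONDITIONAL — a real constructive-QFT
result; it is NOT the continuum limit and NOT the Clay problem.»  SUPPLIER item «Δ1-BOX-SCALAR» under the T⁴-DAG sub-row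
`T4-U1a.S-NE2-D1-DIRICHLET°` (holder: the t4-ne2-p1 lineage, OWNER RULING R20 (c), journal 2026-08-20 l.13903; the holder's scalar region tower
`Support/DirichletScalarTower` displays the binder `hinjS : ∀ k, ‖(DsR (k+1))⁻¹·JsR k − JsR k·(DsR k)⁻¹‖ ≤ e₁ k`, which unfolds definitionally to
THIS road's two-level target at `(N, R) = (L^k, L)` with the level-`k` region spelled `regS L M Ω₀ k` — an ITERATED `refineR`, only
PROPOSITIONALLY equal to `blockReg (L^k) M S`).  Objects as in module M-E (`DirichletBoxTwoLevel`): the `U = 1` SCALAR layer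
`Δ′ = DeltaPs n M a′ = LapS + a′•PiS` ([Balaban1985BackgroundPropagators] (3.24) p. 394 at `U = 1`) compressed to a region exactly as printed
there («Δ′_a↾Ω₀ = Ω₀Δ′_aΩ₀», zero OUTSIDE): `D^Ω = DOm`, King's planting compressed `J^Ω = JOm`, the refined region `Ω′ = refineR N R M Ω = par⁻¹Ω`,
the zero-extended Dirichlet solutions `solExt`.

WHAT THIS FILE ADDS (no new estimate of its own — it re-cuts modules M-PB / M-C / M-E so that OTHER suppliers can plug in):
 * §1 **SOCKET (S1) `injected_le_of_fineH2`** — for an ARBITRARY decidable coarse region `Ω` (not even a union of blocks is needed) and ONE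
   displayed FINE-level binder «the full-torus directional second differences of the fine zero-extended Dirichlet solutions are `ℓ²`-bounded by
   the data: `∀ w, Σ_μ ‖∂′_μᴴ∂′_μ (solExt′ w)‖² ≤ κ²·‖w‖²`» (κ FREE, level-dependent allowed):
   `‖(D′^{Ω′})⁻¹·J^Ω − J^Ω·(D^Ω)⁻¹‖ ≤ 2·√(γ′⁻¹)·κ / N`
   (module M-PB's Fourier-free torus law (C-glob) `norm_pairing_le` + M-C's `form_defect` + the energy bound).  This is the shape asked for by
   the supplier item «Δ1-BESOV» (t4-ne2-formalise-leaf-08-g3, journal l.14717: one-sided Nirenberg ∕ directional Besov-3∕2 translations give the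
   binder with `κ² = O(R·N)` on locally monotone unions of blocks WITHOUT convexity, hence the geometric rate `θ = L^{−1∕2}`).  HONEST LIMIT of
   (S1): the full-torus `H²` seminorm of a zero-extended Dirichlet solution carries the boundary KINK (`(∂′ᴴ∂′v)(x_ext) = −(RN)²v(x_in)`), which is
   of size `≍ R·N·‖w‖²` even on a box — (S1) never beats `N^{−1∕2}`; the rate-`1∕N` law needs the interior∕trace re-cut of socket (S2).
 * §2 **SOCKET (S2) `injected_le_of_budgets`** — for ANY union of unit blocks `Ω = blockReg N S` (S an arbitrary decidable predicate of the unit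
   torus), in ANY decidable SPELLING `p ↔ blockReg N S` of the coarse region (fine region `refineR N R M p`), and TWO displayed budget binders
   (interior diagonal second differences + energies of the Dirichlet solutions, module M-E's `budget`: `Σ_μ budget_μ(solExt f) ≤ Λ₁‖f‖²` at level `N`,
   `≤ Λ₂‖w‖²` at level `RN`; Λ's FREE, level-dependent allowed):
   `‖(D′^{Ω′})⁻¹·J^Ω − J^Ω·(D^Ω)⁻¹‖ ≤ (2 + 8√(2R))·√Λ₁·√Λ₂ / N`.
   With `Λ_N ≤ C·N^{2α}`, `α < 1∕2`, this is the geometric rate `θ = L^{−(1−2α)}` consumed by the holder's `towerLimitRate_dirichletScalar_of_injected`;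
   leaf-07-g4's census `t4/T4-EST-NE2-D1-INJ.md` (H2) locates the discrete `H²` constant of a union of cubes with re-entrant edges at
   `Λ_N ≍ N^{2(1−s*)} = N^{2∕3}` (`s* = 2∕3`), i.e. `α = 1∕3` — the one-level weighted-`H²` estimate that would inhabit (S2) at rate `L^{−k∕3}` is
   NOT proved here and was not found in print for lattice operators (leaf-07-g4's presearch); the numerics see the full rate `L^{−k}`.
 * §3 **THE SPELLING-GENERIC BOX END `injected_le_box_of_iff`** — module M-E's `injected_le_box` (p220819) restated for ANY decidable spelling
   `p ↔ blockReg N S` of a coordinate box (corner-free ⇒ `Λ₁ = Λ₂ = Λ = γ′⁻¹ + 2(1 + (a′γ′⁻¹)²)`, M-E `sum_budget_solExt_le`):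
   `‖(DOm (R·N) M a′ (refineR N R M p))⁻¹·JOm N R M p − JOm N R M p·(DOm N M a′ p)⁻¹‖ ≤ Cbox d R a′ / N`.
   WHY: the holder's level-`k` region `regS L M (blockReg (lev L 0) M S) k` is, for `k ≥ 1`, the iterated refinement
   `refineR (lev L (k−1)) L M (…)` with its own `DecidablePred` instance — equal to `blockReg (lev L k) M S` only after `funext`/`propext`
   (M-E file 1 `refineR_blockReg_iff`), so `injected_le_box` does not apply to it by `exact`; this END does, with
   `p := regS L M Ω₀ k`, `hp` by induction on `k`, giving `hinjS` with `e₁ k = Cbox d L a′ · (lev L k)⁻¹` for every coordinate box `Ω₀`.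

ABSOLUTE RULE (cell, verbatim): «No internally-minted statement may enter as a cited fact. Every hypothesis is either kernel-proved in
this package or a verbatim quotation of a PUBLISHED theorem with page reference. The manuscript(s) under audit are NOT citable for
their own disputed steps — they are the thing under adjudication; programme-internal (2001/route/tribunal) claims are never citable.»
[folklore] finite lattice calculus on the tree's typed `U = 1` objects; the two regularity binders of §1/§2 are DISPLAYED hypotheses on data
(never asserted); nothing printed is a hypothesis.  NOT CLAIMED: the binders themselves for any non-corner-free region; the vector layer
(`calDalev`, the holder's carriers); multi-region `{Ω_j}`; NE2; (CONV-C) as a whole; `BetaPertH`; continuum; Clay.  «not in print; our proof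
attempt».  HONEST DEPENDENCY: continuum YM on T⁴ ⇐ BetaPertH ∧ nine spine estimates (0/9 proved); BetaPertH ⇐ (D1) ∧ (D4) ∧ CAP+tail;
G-an2-4 gates asym, D1 and NE2/3/4.
-/

noncomputable section

open scoped BigOperators ComplexConjugate Matrix Matrix.Norms.L2Operator
open Finset

namespace Summit.QuantumFields.BalabanUV.Beta.GAN24.DirichletBoxSockets

open Literature.MathematicalPhysics.QuantumFieldTheory.Balaban1983to89.B5Prop11Plancherel (Tor fine)
open Literature.MathematicalPhysics.QuantumFieldTheory.Balaban1983to89.B5Action121 (sdiff LapS)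
open Literature.MathematicalPhysics.QuantumFieldTheory.Balaban1983to89.B5Prop11Lower (nsq nsq_nonneg)
open Summit.QuantumFields.BalabanUV.T4Continuum
open Summit.QuantumFields.BalabanUV.T4Continuum.ScalarBlockPlanting (JK0)
open Summit.QuantumFields.BalabanUV.T4Continuum.ScalarAveragedPropagator (gammaPs dirichlet gammaPs_pos dirichlet_nonneg)
open Summit.QuantumFields.BalabanUV.Beta.GAN24.DirichletBoxRegularity (Pdir)
open Summit.QuantumFields.BalabanUV.Beta.GAN24.DirichletBoxPairing (norm_pairing_le)
open Summit.QuantumFields.BalabanUV.Beta.GAN24.DirichletBoxCompression (DOm JOm solExt refineR solExt_apply_of_not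
  dirichlet_solExt_le form_defect opNorm_le_of_pairing)
open Summit.QuantumFields.BalabanUV.Beta.GAN24.DirichletBoxTrace (blockReg)
open Summit.QuantumFields.BalabanUV.Beta.GAN24.DirichletBoxTwoLevelCore (refineR_blockReg_iff)
open Summit.QuantumFields.BalabanUV.Beta.GAN24.DirichletBoxTwoLevel (budget budget_nonneg cDir cDir_nonneg pairing_le IsCoordBox Lam
  Lam_nonneg sum_budget_solExt_le Cbox)

variable {d : ℕ} (N R : ℕ) [NeZero N] [NeZero R] (M : Fin d → ℕ) [hM : ∀ μ, NeZero (M μ)] (a' : ℝ)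

/-! ## §1 Socket (S1): one fine-level full-torus `H²` binder, any coarse region -/

section FineH2

variable (Ω : Tor (fine N M) → Prop) [DecidablePred Ω]

/-- **SOCKET (S1)** — the two-level injected law of the Ω-compressed `U = 1` scalar free tower for an ARBITRARY decidable coarse region `Ω`
(fine region `Ω′ = par⁻¹Ω`), CONDITIONAL on ONE displayed fine-level binder: if the full-torus directional second differences of every fine
zero-extended Dirichlet solution are bounded by the data, `Σ_μ ‖∂′_μᴴ∂′_μ(solExt′ w)‖² ≤ κ²‖w‖²`, then
`‖(D′^{Ω′})⁻¹·J^Ω − J^Ω·(D^Ω)⁻¹‖ ≤ 2·√(γ′⁻¹)·κ / N`.  (M-PB `norm_pairing_le` + M-C `form_defect` + energy bound; κ free.) [folklore] -/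
theorem injected_le_of_fineH2 (hN : 1 ≤ N) (ha' : 0 < a') {κ : ℝ} (hκ : 0 ≤ κ)
    (h : ∀ w : {x // refineR N R M Ω x} → ℂ,
      ∑ μ, nsq (Pdir (fine (R * N) M) ((R * N : ℕ) : ℂ) μ *ᵥ solExt (R * N) M a' (refineR N R M Ω) w) ≤ κ ^ 2 * nsq w) :
    ‖(DOm (R * N) M a' (refineR N R M Ω))⁻¹ * JOm N R M Ω - JOm N R M Ω * (DOm N M a' Ω)⁻¹‖
      ≤ 2 * Real.sqrt ((gammaPs d a')⁻¹) * κ / N := by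
  have hNpos : (0 : ℝ) < N := by exact_mod_cast Nat.pos_of_ne_zero (NeZero.ne N)
  have hγ : 0 ≤ (gammaPs d a')⁻¹ := (inv_pos.mpr (gammaPs_pos (d := d) (a' := a')).1).le
  have hC : 0 ≤ 2 * Real.sqrt ((gammaPs d a')⁻¹) * κ / N := by positivity
  refine opNorm_le_of_pairing _ hC fun w f => ?_
  rw [form_defect N R M a' Ω ha' w f]
  set u := solExt N M a' Ω f with hu
  set v := solExt (R * N) M a' (refineR N R M Ω) w with hv
  refine (norm_pairing_le N R M hN u v).trans ?_
  -- Cauchy–Schwarz over the directions, then the two one-level bounds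
  have h1 : ∑ μ, Real.sqrt (nsq (sdiff (fine N M) (N : ℂ) μ *ᵥ u))
        * Real.sqrt (nsq (Pdir (fine (R * N) M) ((R * N : ℕ) : ℂ) μ *ᵥ v))
      ≤ Real.sqrt (∑ μ, nsq (sdiff (fine N M) (N : ℂ) μ *ᵥ u))
        * Real.sqrt (∑ μ, nsq (Pdir (fine (R * N) M) ((R * N : ℕ) : ℂ) μ *ᵥ v)) :=
    Real.sum_sqrt_mul_sqrt_le _ (fun μ => nsq_nonneg _) (fun μ => nsq_nonneg _)
  have hD : ∑ μ, nsq (sdiff (fine N M) (N : ℂ) μ *ᵥ u) ≤ (gammaPs d a')⁻¹ * nsq f := dirichlet_solExt_le N M a' Ω ha' f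
  have hH : ∑ μ, nsq (Pdir (fine (R * N) M) ((R * N : ℕ) : ℂ) μ *ᵥ v) ≤ κ ^ 2 * nsq w := h w
  have h2 : Real.sqrt (∑ μ, nsq (sdiff (fine N M) (N : ℂ) μ *ᵥ u)) ≤ Real.sqrt ((gammaPs d a')⁻¹) * Real.sqrt (nsq f) := by
    rw [← Real.sqrt_mul hγ]; exact Real.sqrt_le_sqrt hD
  have h3 : Real.sqrt (∑ μ, nsq (Pdir (fine (R * N) M) ((R * N : ℕ) : ℂ) μ *ᵥ v)) ≤ κ * Real.sqrt (nsq w) := by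
    rw [← Real.sqrt_sq hκ, ← Real.sqrt_mul (sq_nonneg κ)]; exact Real.sqrt_le_sqrt hH
  calc 2 / (N : ℝ) * ∑ μ, Real.sqrt (nsq (sdiff (fine N M) (N : ℂ) μ *ᵥ u))
          * Real.sqrt (nsq (Pdir (fine (R * N) M) ((R * N : ℕ) : ℂ) μ *ᵥ v))
      ≤ 2 / (N : ℝ) * ((Real.sqrt ((gammaPs d a')⁻¹) * Real.sqrt (nsq f)) * (κ * Real.sqrt (nsq w))) :=
        mul_le_mul_of_nonneg_left (h1.trans (mul_le_mul h2 h3 (Real.sqrt_nonneg _) (by positivity)))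
          (div_nonneg zero_le_two hNpos.le)
    _ = 2 * Real.sqrt ((gammaPs d a')⁻¹) * κ / N * Real.sqrt (nsq w) * Real.sqrt (nsq f) := by ring

end FineH2

/-! ## §2 Socket (S2): two budget binders, any union of unit blocks, any spelling of the region -/

section Budgets

variable (S : Tor M → Prop) [DecidablePred S] (p : Tor (fine N M) → Prop) [DecidablePred p]

omit [DecidablePred S] [DecidablePred p] in
/-- a spelling `p ↔ blockReg N S` of the coarse region refines to a spelling of the fine region: `refineR N R M p ↔ blockReg (RN) S`.
[folklore] -/
theorem refineR_iff_blockReg (hp : ∀ y, p y ↔ blockReg N M S y) (x : Tor (fine (R * N) M)) :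
    refineR N R M p x ↔ blockReg (R * N) M S x := by
  rw [← refineR_blockReg_iff N R M S x]
  exact hp _

/-- **SOCKET (S2)** — the two-level injected law of the Ω-compressed `U = 1` scalar free tower on an ARBITRARY union of unit blocks
`Ω = blockReg N S`, in ANY decidable spelling `p ↔ blockReg N S` (fine region `refineR N R M p`), CONDITIONAL on TWO displayed budget
binders (energy + interior diagonal second differences of the zero-extended Dirichlet solutions at the two levels, constants free):
`‖(D′^{Ω′})⁻¹·J^Ω − J^Ω·(D^Ω)⁻¹‖ ≤ (2 + 8√(2R))·√Λ₁·√Λ₂ / N`.  (M-E `pairing_le` + M-C `form_defect`.)  With `Λ ≤ C·N^{2α}`, `α < 1/2`, this is the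
geometric rate `L^{−(1−2α)k}` along the tower. [folklore] -/
theorem injected_le_of_budgets (hp : ∀ y, p y ↔ blockReg N M S y) (hN : 1 ≤ N) (ha' : 0 < a') {Λ₁ Λ₂ : ℝ} (hΛ₁ : 0 ≤ Λ₁) (hΛ₂ : 0 ≤ Λ₂)
    (h₁ : ∀ f : {y // p y} → ℂ, ∑ μ, budget M S N μ (solExt N M a' p f) ≤ Λ₁ * nsq f)
    (h₂ : ∀ w : {x // refineR N R M p x} → ℂ, ∑ μ, budget M S (R * N) μ (solExt (R * N) M a' (refineR N R M p) w) ≤ Λ₂ * nsq w) :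
    ‖(DOm (R * N) M a' (refineR N R M p))⁻¹ * JOm N R M p - JOm N R M p * (DOm N M a' p)⁻¹‖
      ≤ cDir R * Real.sqrt Λ₁ * Real.sqrt Λ₂ / N := by
  have hNpos : (0 : ℝ) < N := by exact_mod_cast Nat.pos_of_ne_zero (NeZero.ne N)
  have hC : 0 ≤ cDir R * Real.sqrt Λ₁ * Real.sqrt Λ₂ / N :=
    div_nonneg (mul_nonneg (mul_nonneg (cDir_nonneg R) (Real.sqrt_nonneg _)) (Real.sqrt_nonneg _)) hNpos.le
  refine opNorm_le_of_pairing _ hC fun w f => ?_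
  rw [form_defect N R M a' p ha' w f]
  set u := solExt N M a' p f with hu
  set v := solExt (R * N) M a' (refineR N R M p) w with hv
  have hu0 : ∀ y, ¬ blockReg N M S y → u y = 0 := fun y hy => solExt_apply_of_not N M a' _ f (fun h => hy ((hp y).mp h))
  have hv0 : ∀ x, ¬ blockReg (R * N) M S x → v x = 0 :=
    fun x hx => solExt_apply_of_not (R * N) M a' _ w (fun h => hx ((refineR_iff_blockReg N R M S p hp x).mp h))
  refine (pairing_le N R M S hN hu0 hv0).trans ?_
  have hbu : ∑ μ, budget M S N μ u ≤ Λ₁ * nsq f := h₁ f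
  have hbv : ∑ μ, budget M S (R * N) μ v ≤ Λ₂ * nsq w := h₂ w
  calc cDir R / N * (Real.sqrt (∑ μ, budget M S N μ u) * Real.sqrt (∑ μ, budget M S (R * N) μ v))
      ≤ cDir R / N * (Real.sqrt (Λ₁ * nsq f) * Real.sqrt (Λ₂ * nsq w)) := by
        refine mul_le_mul_of_nonneg_left (mul_le_mul (Real.sqrt_le_sqrt hbu) (Real.sqrt_le_sqrt hbv) (Real.sqrt_nonneg _)
          (Real.sqrt_nonneg _)) (div_nonneg (cDir_nonneg R) hNpos.le)
    _ = cDir R * Real.sqrt Λ₁ * Real.sqrt Λ₂ / N * Real.sqrt (nsq w) * Real.sqrt (nsq f) := by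
        rw [Real.sqrt_mul hΛ₁, Real.sqrt_mul hΛ₂]; ring

/-! ## §3 The spelling-generic box END -/

/-- **THE BOX END IN ANY SPELLING** (module M-E's `injected_le_box`, p220819, for every decidable `p ↔ blockReg N S` of a coordinate box `S`
of unit blocks; the fine level in the `refineR` spelling, instances generic): `‖(D′^{Ω′})⁻¹·J^Ω − J^Ω·(D^Ω)⁻¹‖ ≤ Cbox d R a′ / N`,
`Cbox = (2 + 8√(2R))·(γ′⁻¹ + 2(1 + (a′γ′⁻¹)²))`.  USE (the holder's tower, `Support/DirichletScalarTower`): with `Ω₀ := blockReg (lev L 0) M S`,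
`p := regS L M Ω₀ k` and `hp` by induction on `k` (`regS_succ` + M-E file 1 `refineR_blockReg_iff`), this is `hinjS` at level `k` with
`e₁ k = Cbox d L a′ / lev L k` — rate `L^{−k}`. [folklore] -/
theorem injected_le_box_of_iff (hS : IsCoordBox M S) (hp : ∀ y, p y ↔ blockReg N M S y) (hN : 1 ≤ N) (ha' : 0 < a') :
    ‖(DOm (R * N) M a' (refineR N R M p))⁻¹ * JOm N R M p - JOm N R M p * (DOm N M a' p)⁻¹‖ ≤ Cbox d R a' / N := by
  have hΛ := Lam_nonneg (d := d) a'
  have h := injected_le_of_budgets N R M a' S p hp hN ha' hΛ hΛ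
    (fun f => sum_budget_solExt_le M S hS N ha' p hp f)
    (fun w => sum_budget_solExt_le M S hS (R * N) ha' (refineR N R M p) (refineR_iff_blockReg N R M S p hp) w)
  rw [Cbox]
  calc _ ≤ cDir R * Real.sqrt (Lam d a') * Real.sqrt (Lam d a') / N := h
    _ = cDir R * Lam d a' / N := by rw [mul_assoc, Real.mul_self_sqrt hΛ]

end Budgets

end Summit.QuantumFields.BalabanUV.Beta.GAN24.DirichletBoxSockets

end
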